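import Summits.KontsevichZagierPeriods.KontsevichZagierPeriods.Theorems.UnfoldedStokesStokesGenerationFibrewiseDecomposableAPI
import Summits.KontsevichZagierPeriods.KontsevichZagierPeriods.Theorems.UnfoldedStokesStokesGenerationFibrewiseClosure
import Summits.KontsevichZagierPeriods.KontsevichZagierPeriods.Theorems.UnfoldedStokesStokesGenerationFibrewiseClosureCongr
import Summits.KontsevichZagierPeriods.KontsevichZagierPeriods.Theorems.UnfoldedStokesStokesGenerationFibrewiseRungDimOneAngular

/-!
# `StokesGeneration` (stmt-KontsevichZagierPeriods-3586) — line `fibrewise_stokes`, stub `stub_intervalTransport`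

Registered stub T1 (wave 1, lead c6) of the line `fibrewise_stokes` of the crux `StokesGeneration` (route
UnfoldedStokes): **Kontsevich–Zagier's rule (2) between two different intervals**, dimension one, for
`ℚ`-semialgebraic `C¹` data, inside the economy of the residual S2 (`FibStokesDecomposable`,
`Theorems/UnfoldedStokesDefs.lean`). If `φ : [α,β] → [γ,δ]` (algebraic endpoints) fixes the endpoints
(`φ α = γ`, `φ β = δ`), maps `(α,β)` into `(γ,δ)`, and `k₁ = (k₂∘φ)·φ′` on `(α,β)`, then the difference of the
two normalised cube integrands `(β−α)·k₁(α+(β−α)s) − (δ−γ)·k₂(γ+(δ−γ)s)` is fibrewise-Stokes decomposable on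
`[0,1]`.

Proof (affine renormalisation of the landed rung 2′ `fibStokesDecomposable_transport`). Put
`f(s) = (δ−γ)·k₂(γ+(δ−γ)s)`, `ψ(s) = (φ(α+(β−α)s) − γ)/(δ−γ)`; then `ψ 0 = 0`, `ψ 1 = 1`, `ψ` maps `[0,1]`
into `[0,1]` and `(0,1)` into `(0,1)`, and `f(ψ s)·ψ′(s) = (β−α)·k₂(φ u)·φ′(u) = (β−α)·k₁(u)`,
`u = α+(β−α)s` — on the CLOSED interval, because the identity `k₁ = (k₂∘φ)φ′` of continuous functions
extends from `(α,β)` to `[α,β]`. So the closed-interval representation with integrand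
`(δ−γ)·k₂(γ+(δ−γ)s) − (β−α)·k₁(α+(β−α)s)` (`exists_cubeRep_one`) carries the rule-(2) relator `f − (f∘ψ)ψ′`
of `[0,1]`, is decomposable by rung 2′, and its negative (`fibStokesDecomposable_neg`,
`fibStokesDecomposable_congr_off_null` with the empty null set) is the target. Semialgebraicity of the
renormalised data: composition of the given graphs with the affine `ℚ`-semialgebraic charts
(`IsSemialgebraicFunOn.comp_isSemialgebraicMapOn_holds`); derivatives by the chain rule.

References: M. Kontsevich, D. Zagier, *Periods* (2001), §1.2 rule (2); J. Ayoub, Ann. of Math. 181 (2015),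
Rem. 1.5; J. Bochnak, M. Coste, M.-F. Roy, *Real Algebraic Geometry* (1998), Prop. 2.2.6.
-/

noncomputable section

-- `Summit.KontsevichZagierPeriods.KontsevichZagierPeriods.…` is the tree's mandated layout (single-conjunct summit).
set_option linter.dupNamespace false

namespace Summit.KontsevichZagierPeriods.KontsevichZagierPeriods.Cruxes.StokesGeneration.FibrewiseStokes

open MeasureTheory Set
open Literature.NumberTheory.Transcendental
open Literature.NumberTheory.Transcendental.KZ
open Literature.ModelTheory.ExponentialFields (IsSemialgebraic)

/-- The affine chart `s ↦ a + (b − a)s` maps `[0,1]` into `[a,b]` (`a < b`). [folklore] -/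
private theorem intervalTransport_affine_mem_Icc {a b : ℝ} (hab : a < b) {s : ℝ}
    (hs : s ∈ Set.Icc (0:ℝ) 1) : a + (b - a) * s ∈ Set.Icc a b := by
  have hba : 0 ≤ b - a := (sub_pos.2 hab).le
  have h := mul_le_of_le_one_right hba hs.2
  exact ⟨le_add_of_nonneg_right (mul_nonneg hba hs.1), by linarith⟩

/-- The affine chart `s ↦ a + (b − a)s` maps `(0,1)` into `(a,b)` (`a < b`). [folklore] -/
private theorem intervalTransport_affine_mem_Ioo {a b : ℝ} (hab : a < b) {s : ℝ}
    (hs : s ∈ Set.Ioo (0:ℝ) 1) : a + (b - a) * s ∈ Set.Ioo a b := by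
  have hba : 0 < b - a := sub_pos.2 hab
  have h := mul_lt_of_lt_one_right hba hs.2
  exact ⟨lt_add_of_pos_right a (mul_pos hba hs.1), by linarith⟩

/-- **Registered stub `stub_intervalTransport` (T1): rule (2) between two different intervals, dimension one,
semialgebraic `C¹` data** (affine renormalisation of rung 2′ `fibStokesDecomposable_transport`): if
`φ : [α,β] → [γ,δ]` is a `ℚ`-semialgebraic `C¹` endpoint-fixing reparametrisation and `k₁ = (k₂∘φ)·φ′` on
`(α,β)`, then `(β−α)k₁(α+(β−α)s) − (δ−γ)k₂(γ+(δ−γ)s)` is fibrewise-Stokes decomposable on `[0,1]`.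
[cite: KontsevichZagier2001, §1.2 rule (2)] -/
theorem stub_intervalTransport (α β γ δ : ℝ) (hαβ : α < β) (hγδ : γ < δ)
    (hα : IsAlgebraic ℚ α) (hβ : IsAlgebraic ℚ β) (hγ : IsAlgebraic ℚ γ) (hδ : IsAlgebraic ℚ δ)
    (k₁ k₂ k₂' φ φ' : ℝ → ℝ)
    (hk₁ : IsSemialgebraicFunOn ℚ {z : Fin 1 → ℝ | z 0 ∈ Set.Icc α β} (fun z => k₁ (z 0)))
    (hk₂ : IsSemialgebraicFunOn ℚ {z : Fin 1 → ℝ | z 0 ∈ Set.Icc γ δ} (fun z => k₂ (z 0)))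
    (hk₂' : IsSemialgebraicFunOn ℚ {z : Fin 1 → ℝ | z 0 ∈ Set.Icc γ δ} (fun z => k₂' (z 0)))
    (hφ : IsSemialgebraicFunOn ℚ {z : Fin 1 → ℝ | z 0 ∈ Set.Icc α β} (fun z => φ (z 0)))
    (hφ' : IsSemialgebraicFunOn ℚ {z : Fin 1 → ℝ | z 0 ∈ Set.Icc α β} (fun z => φ' (z 0)))
    (hk₁c : ContinuousOn k₁ (Set.Icc α β)) (hk₂c : ContinuousOn k₂ (Set.Icc γ δ))
    (hk₂'c : ContinuousOn k₂' (Set.Icc γ δ)) (hφc : ContinuousOn φ (Set.Icc α β))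
    (hφ'c : ContinuousOn φ' (Set.Icc α β))
    (hk₂d : ∀ u ∈ Set.Ioo γ δ, HasDerivAt k₂ (k₂' u) u) (hφd : ∀ u ∈ Set.Ioo α β, HasDerivAt φ (φ' u) u)
    (hφα : φ α = γ) (hφβ : φ β = δ) (hφI : ∀ u ∈ Set.Ioo α β, φ u ∈ Set.Ioo γ δ)
    (hrel : ∀ u ∈ Set.Ioo α β, k₁ u = k₂ (φ u) * φ' u) :
    FibStokesDecomposable 1 (fun s => (β - α) * k₁ (α + (β - α) * s 0) - (δ - γ) * k₂ (γ + (δ - γ) * s 0)) := by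
  have hδγ : 0 < δ - γ := sub_pos.2 hγδ
  have hne : δ - γ ≠ 0 := hδγ.ne'
  -- the affine charts `u = α + (β - α)s` of `[α,β]` and `v = γ + (δ - γ)s` of `[γ,δ]`
  have hA : ∀ s ∈ Set.Icc (0:ℝ) 1, α + (β - α) * s ∈ Set.Icc α β :=
    fun s hs => intervalTransport_affine_mem_Icc hαβ hs
  have hAo : ∀ s ∈ Set.Ioo (0:ℝ) 1, α + (β - α) * s ∈ Set.Ioo α β :=
    fun s hs => intervalTransport_affine_mem_Ioo hαβ hs
  have hC : ∀ s ∈ Set.Icc (0:ℝ) 1, γ + (δ - γ) * s ∈ Set.Icc γ δ :=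
    fun s hs => intervalTransport_affine_mem_Icc hγδ hs
  have hCo : ∀ s ∈ Set.Ioo (0:ℝ) 1, γ + (δ - γ) * s ∈ Set.Ioo γ δ :=
    fun s hs => intervalTransport_affine_mem_Ioo hγδ hs
  -- `φ` maps `[α,β]` into `[γ,δ]`
  have hφIcc : ∀ a ∈ Set.Icc α β, φ a ∈ Set.Icc γ δ := by
    intro a ha
    rcases ha.1.eq_or_lt with h1 | h1
    · rw [← h1, hφα]; exact Set.left_mem_Icc.2 hγδ.le
    rcases ha.2.eq_or_lt with h2 | h2
    · rw [h2, hφβ]; exact Set.right_mem_Icc.2 hγδ.le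
    exact Set.Ioo_subset_Icc_self (hφI a ⟨h1, h2⟩)
  -- the identity `k₁ = (k₂ ∘ φ)·φ′` of continuous functions extends to the closed interval
  have hrel' : ∀ u ∈ Set.Icc α β, k₁ u = k₂ (φ u) * φ' u := by
    have hc : ContinuousOn (fun u => k₂ (φ u) * φ' u) (Set.Icc α β) :=
      (hk₂c.comp hφc hφIcc).mul hφ'c
    exact Set.EqOn.of_subset_closure (f := k₁) (g := fun u => k₂ (φ u) * φ' u) hrel hk₁c hc
      Set.Ioo_subset_Icc_self (by rw [closure_Ioo hαβ.ne])
  -- `ℚ`-semialgebraicity of the renormalised data on the unit cube of `ℝ¹`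
  have hS := isSemialgebraic_cubePi_one
  have hmem : ∀ z ∈ Set.pi Set.univ (fun _ : Fin 1 => Set.Icc (0:ℝ) 1), z 0 ∈ Set.Icc (0:ℝ) 1 :=
    fun z hz => hz 0 (Set.mem_univ _)
  have hΦA : IsSemialgebraicMapOn ℚ (Set.pi Set.univ (fun _ : Fin 1 => Set.Icc (0:ℝ) 1))
      (fun z (_ : Fin 1) => α + (β - α) * z 0) :=
    IsSemialgebraicMapOn.of_forall hS fun _ =>
      (isSemialgebraicFunOn_const_of_isAlgebraic hS hα).fun_add
        ((isSemialgebraicFunOn_const_of_isAlgebraic hS (hβ.sub hα)).fun_mul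
          (isSemialgebraicFunOn_apply hS 0))
  have hΦC : IsSemialgebraicMapOn ℚ (Set.pi Set.univ (fun _ : Fin 1 => Set.Icc (0:ℝ) 1))
      (fun z (_ : Fin 1) => γ + (δ - γ) * z 0) :=
    IsSemialgebraicMapOn.of_forall hS fun _ =>
      (isSemialgebraicFunOn_const_of_isAlgebraic hS hγ).fun_add
        ((isSemialgebraicFunOn_const_of_isAlgebraic hS (hδ.sub hγ)).fun_mul
          (isSemialgebraicFunOn_apply hS 0))
  have hΦAm : Set.MapsTo (fun (z : Fin 1 → ℝ) (_ : Fin 1) => α + (β - α) * z 0)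
      (Set.pi Set.univ (fun _ : Fin 1 => Set.Icc (0:ℝ) 1)) {w : Fin 1 → ℝ | w 0 ∈ Set.Icc α β} :=
    fun z hz => hA _ (hmem z hz)
  have hΦCm : Set.MapsTo (fun (z : Fin 1 → ℝ) (_ : Fin 1) => γ + (δ - γ) * z 0)
      (Set.pi Set.univ (fun _ : Fin 1 => Set.Icc (0:ℝ) 1)) {w : Fin 1 → ℝ | w 0 ∈ Set.Icc γ δ} :=
    fun z hz => hC _ (hmem z hz)
  have sk₁ : IsSemialgebraicFunOn ℚ (Set.pi Set.univ (fun _ : Fin 1 => Set.Icc (0:ℝ) 1))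
      (fun z => k₁ (α + (β - α) * z 0)) := hk₁.comp_isSemialgebraicMapOn_holds hΦA hΦAm
  have sk₂ : IsSemialgebraicFunOn ℚ (Set.pi Set.univ (fun _ : Fin 1 => Set.Icc (0:ℝ) 1))
      (fun z => k₂ (γ + (δ - γ) * z 0)) := hk₂.comp_isSemialgebraicMapOn_holds hΦC hΦCm
  have sk₂' : IsSemialgebraicFunOn ℚ (Set.pi Set.univ (fun _ : Fin 1 => Set.Icc (0:ℝ) 1))
      (fun z => k₂' (γ + (δ - γ) * z 0)) := hk₂'.comp_isSemialgebraicMapOn_holds hΦC hΦCm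
  have sφ : IsSemialgebraicFunOn ℚ (Set.pi Set.univ (fun _ : Fin 1 => Set.Icc (0:ℝ) 1))
      (fun z => φ (α + (β - α) * z 0)) := hφ.comp_isSemialgebraicMapOn_holds hΦA hΦAm
  have sφ' : IsSemialgebraicFunOn ℚ (Set.pi Set.univ (fun _ : Fin 1 => Set.Icc (0:ℝ) 1))
      (fun z => φ' (α + (β - α) * z 0)) := hφ'.comp_isSemialgebraicMapOn_holds hΦA hΦAm
  have cβα : IsSemialgebraicFunOn ℚ (Set.pi Set.univ (fun _ : Fin 1 => Set.Icc (0:ℝ) 1))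
      (fun _ => β - α) := isSemialgebraicFunOn_const_of_isAlgebraic hS (hβ.sub hα)
  have cδγ : IsSemialgebraicFunOn ℚ (Set.pi Set.univ (fun _ : Fin 1 => Set.Icc (0:ℝ) 1))
      (fun _ => δ - γ) := isSemialgebraicFunOn_const_of_isAlgebraic hS (hδ.sub hγ)
  have cγ : IsSemialgebraicFunOn ℚ (Set.pi Set.univ (fun _ : Fin 1 => Set.Icc (0:ℝ) 1))
      (fun _ => γ) := isSemialgebraicFunOn_const_of_isAlgebraic hS hγ
  -- the four data of rung 2′: `f`, `f′`, `ψ`, `ψ′`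
  have hf : IsSemialgebraicFunOn ℚ (Set.pi Set.univ (fun _ : Fin 1 => Set.Icc (0:ℝ) 1))
      (fun z => (δ - γ) * k₂ (γ + (δ - γ) * z 0)) := cδγ.fun_mul sk₂
  have hf' : IsSemialgebraicFunOn ℚ (Set.pi Set.univ (fun _ : Fin 1 => Set.Icc (0:ℝ) 1))
      (fun z => (δ - γ) * (k₂' (γ + (δ - γ) * z 0) * (δ - γ))) := cδγ.fun_mul (sk₂'.fun_mul cδγ)
  have hψ : IsSemialgebraicFunOn ℚ (Set.pi Set.univ (fun _ : Fin 1 => Set.Icc (0:ℝ) 1))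
      (fun z => (φ (α + (β - α) * z 0) - γ) / (δ - γ)) := (sφ.fun_sub cγ).div cδγ fun _ _ => hne
  have hψ' : IsSemialgebraicFunOn ℚ (Set.pi Set.univ (fun _ : Fin 1 => Set.Icc (0:ℝ) 1))
      (fun z => φ' (α + (β - α) * z 0) * (β - α) / (δ - γ)) := (sφ'.fun_mul cβα).div cδγ fun _ _ => hne
  -- continuity on `[0,1]`
  have haffA : Continuous fun s : ℝ => α + (β - α) * s := by fun_prop
  have haffC : Continuous fun s : ℝ => γ + (δ - γ) * s := by fun_prop
  have hk₁A : ContinuousOn (fun s => k₁ (α + (β - α) * s)) (Set.Icc (0:ℝ) 1) :=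
    hk₁c.comp haffA.continuousOn hA
  have hk₂C : ContinuousOn (fun s => k₂ (γ + (δ - γ) * s)) (Set.Icc (0:ℝ) 1) :=
    hk₂c.comp haffC.continuousOn hC
  have hk₂'C : ContinuousOn (fun s => k₂' (γ + (δ - γ) * s)) (Set.Icc (0:ℝ) 1) :=
    hk₂'c.comp haffC.continuousOn hC
  have hφA : ContinuousOn (fun s => φ (α + (β - α) * s)) (Set.Icc (0:ℝ) 1) :=
    hφc.comp haffA.continuousOn hA
  have hφ'A : ContinuousOn (fun s => φ' (α + (β - α) * s)) (Set.Icc (0:ℝ) 1) :=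
    hφ'c.comp haffA.continuousOn hA
  have hfc : ContinuousOn (fun s => (δ - γ) * k₂ (γ + (δ - γ) * s)) (Set.Icc (0:ℝ) 1) :=
    continuousOn_const.mul hk₂C
  have hf'c : ContinuousOn (fun s => (δ - γ) * (k₂' (γ + (δ - γ) * s) * (δ - γ))) (Set.Icc (0:ℝ) 1) :=
    continuousOn_const.mul (hk₂'C.mul continuousOn_const)
  have hψc : ContinuousOn (fun s => (φ (α + (β - α) * s) - γ) / (δ - γ)) (Set.Icc (0:ℝ) 1) :=
    (hφA.sub continuousOn_const).div_const _
  have hψ'c : ContinuousOn (fun s => φ' (α + (β - α) * s) * (β - α) / (δ - γ)) (Set.Icc (0:ℝ) 1) :=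
    (hφ'A.mul continuousOn_const).div_const _
  -- derivatives inside (chain rule along the affine charts)
  have hlinA : ∀ u : ℝ, HasDerivAt (fun s : ℝ => α + (β - α) * s) (β - α) u := fun u => by
    simpa using ((hasDerivAt_id u).const_mul (β - α)).const_add α
  have hlinC : ∀ u : ℝ, HasDerivAt (fun s : ℝ => γ + (δ - γ) * s) (δ - γ) u := fun u => by
    simpa using ((hasDerivAt_id u).const_mul (δ - γ)).const_add γ
  have hfd : ∀ u ∈ Set.Ioo (0:ℝ) 1, HasDerivAt (fun s => (δ - γ) * k₂ (γ + (δ - γ) * s))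
      ((δ - γ) * (k₂' (γ + (δ - γ) * u) * (δ - γ))) u := fun u hu =>
    ((hk₂d _ (hCo u hu)).comp u (hlinC u)).const_mul (δ - γ)
  have hψd : ∀ u ∈ Set.Ioo (0:ℝ) 1, HasDerivAt (fun s => (φ (α + (β - α) * s) - γ) / (δ - γ))
      (φ' (α + (β - α) * u) * (β - α) / (δ - γ)) u := fun u hu =>
    (((hφd _ (hAo u hu)).comp u (hlinA u)).sub_const γ).div_const (δ - γ)
  -- `ψ` is an orientation-preserving reparametrisation of `[0,1]`
  have hψ0 : (φ (α + (β - α) * 0) - γ) / (δ - γ) = 0 := by simp [hφα]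
  have hψ1 : (φ (α + (β - α) * 1) - γ) / (δ - γ) = 1 := by
    rw [mul_one, add_sub_cancel, hφβ, div_self hne]
  have hψI : ∀ u ∈ Set.Icc (0:ℝ) 1, (φ (α + (β - α) * u) - γ) / (δ - γ) ∈ Set.Icc (0:ℝ) 1 :=
    fun u hu => by
      have h := hφIcc _ (hA u hu)
      exact ⟨div_nonneg (sub_nonneg.2 h.1) hδγ.le, (div_le_one hδγ).2 (sub_le_sub_right h.2 γ)⟩
  have hψo : ∀ u ∈ Set.Ioo (0:ℝ) 1, (φ (α + (β - α) * u) - γ) / (δ - γ) ∈ Set.Ioo (0:ℝ) 1 :=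
    fun u hu => by
      have h := hφI _ (hAo u hu)
      exact ⟨div_pos (sub_pos.2 h.1) hδγ, (div_lt_one hδγ).2 (sub_lt_sub_right h.2 γ)⟩
  -- the closed-interval representation carrying the rule-(2) relator `f − (f∘ψ)ψ′`
  obtain ⟨t, ht, hti⟩ := exists_cubeRep_one
    (fun s => (δ - γ) * k₂ (γ + (δ - γ) * s) - (β - α) * k₁ (α + (β - α) * s))
    (hf.fun_sub (cβα.fun_mul sk₁)) (hfc.sub (continuousOn_const.mul hk₁A))
  have hdec : FibStokesDecomposable 1 t.integrand :=
    fibStokesDecomposable_transport (fun s => (δ - γ) * k₂ (γ + (δ - γ) * s))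
      (fun s => (δ - γ) * (k₂' (γ + (δ - γ) * s) * (δ - γ)))
      (fun s => (φ (α + (β - α) * s) - γ) / (δ - γ))
      (fun s => φ' (α + (β - α) * s) * (β - α) / (δ - γ))
      hf hf' hψ hψ' hfc hf'c hψc hψ'c hfd hψd hψ0 hψ1 hψI hψo t ht fun z hz => by
        have hu := hA _ (hmem z hz)
        have key : γ + (δ - γ) * ((φ (α + (β - α) * z 0) - γ) / (δ - γ)) = φ (α + (β - α) * z 0) := by
          field_simp
          ring
        rw [hti]
        beta_reduce
        rw [key, hrel' _ hu]
        field_simp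
  -- its negative is the target, everywhere on the cube
  refine fibStokesDecomposable_congr_off_null 1 _ _ ∅
    Literature.ModelTheory.ExponentialFields.isSemialgebraic_empty measure_empty ?_
    (fibStokesDecomposable_neg 1 _ hdec)
  intro x _ _
  show -t.integrand x = _
  rw [hti]
  beta_reduce
  ring

end Summit.KontsevichZagierPeriods.KontsevichZagierPeriods.Cruxes.StokesGeneration.FibrewiseStokes

end
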